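import Mathlib
import Literature.NumberTheory.LFunctions.Zhang2022.Section4Statements
import Literature.NumberTheory.LFunctions.Zhang2022.Section2FunctionalEquation
import Literature.NumberTheory.LFunctions.Zhang2022.Section2Lemma23Inputs
import Literature.NumberTheory.LFunctions.Zhang2022.Section6ZfacSize
import Literature.NumberTheory.LFunctions.DirichletLFunctionBounds
import HarnessLib

/-!
# Zhang (2022) §4, Lemma 4.4: polynomial growth of `L(s,ψ)L(s,ψχ)` on the vertical strip of the
# residue-theorem step ("By the residue theorem, `L(s,ψ)L(s,ψχ) = (2πi)⁻¹(∫_{(1)} − ∫_{(−σ−1/2)}) …`")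

Topic `Literature/NumberTheory/LFunctions/Zhang2022` (Landau–Siegel adjudication tree;
verdict-neutral). Y. Zhang, *Discrete mean estimates and the Landau–Siegel zero*,
arXiv:2211.02515v1 (2022) [Zhang2022LandauSiegel] — **an unrefereed manuscript under adjudication**
— §4, proof of Lemma 4.4, p. 19 (tex L1049–L1052; DAG `Z22:§4.u025`):

> By the residue theorem,
> `L(s,ψ)L(s,ψχ) = (2πi)⁻¹(∫_{(1)} − ∫_{(−σ−1/2)}) L(s+w,ψ)L(s+w,ψχ)P^{(9/5)w} ω₁(w)dw/w`.

Moving the line `Re w = 1` to `Re w = −σ − 1/2` across the pole `w = 0` requires, besides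
Cauchy's theorem on the rectangles `[−σ−1/2, 1] × [−V, V]`, that the horizontal sides tend to `0`
as `V → ∞`: the Gaussian `ω₁(u ± iV) = e^{(u²−V²)/(4𝓛³⁰)}` beats any polynomial, so what is needed
is POLYNOMIAL GROWTH of `L(z,ψ)L(z,ψχ)` in `|Im z|` on the strip `−1/2 ≤ Re z ≤ 3`. This file PROVES
it (theorems only; no definition, no new named fact) from the tree:

* `Section4.norm_Zfac_conj` — `|Z(z̄,θ)| = |Z(z,θ)|` (the printed `Γ`-quotients, `Γ(ū) = \overline{Γ(u)}`);
* `Section4.norm_Zfac_le_poly_abs` — `|Z(z,θ)| ≤ 64π²k²(1+|Im z|)^{3/2}` for `−1 ≤ Re z < 1`,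
  `|Im z| ≥ 1` (the tree's `Section6Statements.norm_Zfac_le_poly`, Stirling, extended to `Im z ≤ −1`);
* `Section4.norm_LFunction_le_strip` — **for `θ` primitive mod `k ≠ 1`, `−1/2 ≤ Re z ≤ 3`,
  `|Im z| ≥ 1`: `‖L(z,θ)‖ ≤ 160π²k³Z·(1+|Im z|)³`**, `Z = Σ_{n≥1} n^{−5/4}` (crude MV Lemma 10.15
  `DirichletZFR.norm_LFunction_le_of_re_ge` for `Re z ≥ 1/4`; the functional equation (2.2)
  `GammaFactor.LFunction_eq_Zfac_mul` and the `Z`-bound for `Re z < 1/4`);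
* `Section4.norm_LL_le_strip` — the product bound for `L(z,ψ)L(z,ψχ)`, `ψ ∈ Ψ`, `D ≥ 3`.

The residue-theorem step itself (`Section4.residueSplit_holds`) is the sibling file
`Section4ResidueSplit.lean`. Nothing about Theorems 1–2 of the source or about Landau–Siegel zeros
is stated or implied.

## References

* Y. Zhang, arXiv:2211.02515v1 (2022), §4 p. 19 (proof of Lemma 4.4), §2 (2.2)–(2.5).
  [cite: Zhang2022LandauSiegel, §4 Lemma 4.4 (proof) p. 19]
* H. L. Montgomery, R. C. Vaughan, *Multiplicative Number Theory I* (2007), Lemma 10.15.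
  [cite: MontgomeryVaughan2007, §10.2 Lemma 10.15]
-/

noncomputable section

open Complex Real ComplexConjugate

namespace Literature.NumberTheory.LFunctions.Zhang2022.Section4

open Skeleton

/-! ### `|Z(z̄,θ)| = |Z(z,θ)|` and the `Z`-bound for `|Im z| ≥ 1` -/

/-- For a positive real base the modulus of `b^w` depends only on `Re w`; in particular
`|b^{w̄'}| = |b^{w}|` whenever `Re w' = Re w`. [folklore] -/
private theorem norm_cpow_eq_of_re_eq {b : ℝ} (hb : 0 < b) {w w' : ℂ} (h : w'.re = w.re) :
    ‖(b : ℂ) ^ w'‖ = ‖(b : ℂ) ^ w‖ := by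
  rw [Complex.norm_cpow_eq_rpow_re_of_pos hb, Complex.norm_cpow_eq_rpow_re_of_pos hb, h]

/-- `|Γ(ū)| = |Γ(u)|`. [folklore] -/
private theorem norm_Gamma_conj (u : ℂ) : ‖Complex.Gamma (conj u)‖ = ‖Complex.Gamma u‖ := by
  rw [Complex.Gamma_conj, Complex.norm_conj]

/-- **`|Z(z̄,θ)| = |Z(z,θ)|`**: in the printed `Γ`-quotients (2.2) every factor has a modulus that is
even in `Im z` (`|π^{w}|`, `|k^{−w}|` depend on `Re w` only; `Γ(ū) = \overline{Γ(u)}`).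
[cite: Zhang2022LandauSiegel, §2 (2.2)] -/
theorem norm_Zfac_conj {k : ℕ} [NeZero k] (θ : DirichletCharacter ℂ k) (z : ℂ) :
    ‖GammaFactor.Zfac θ (conj z)‖ = ‖GammaFactor.Zfac θ z‖ := by
  have hk : (0 : ℝ) < k := Nat.cast_pos.mpr (NeZero.pos k)
  have e1 : ((1 : ℂ) - conj z) / 2 = conj ((1 - z) / 2) := by
    simp [map_div₀, map_sub, map_ofNat]
  have e2 : conj z / 2 = conj (z / 2) := by simp [map_div₀, map_ofNat]
  have e3 : ((2 : ℂ) - conj z) / 2 = conj ((2 - z) / 2) := by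
    simp [map_div₀, map_sub, map_ofNat]
  have e4 : ((1 : ℂ) + conj z) / 2 = conj ((1 + z) / 2) := by
    simp [map_div₀, map_add, map_ofNat]
  have hπ1 : ‖(π : ℂ) ^ (conj z - 1 / 2)‖ = ‖(π : ℂ) ^ (z - 1 / 2)‖ :=
    norm_cpow_eq_of_re_eq Real.pi_pos (by simp)
  have hk1 : ‖((k : ℕ) : ℂ) ^ (-conj z)‖ = ‖((k : ℕ) : ℂ) ^ (-z)‖ := by
    have := norm_cpow_eq_of_re_eq hk (w := -z) (w' := -conj z) (by simp)
    simpa using this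
  unfold GammaFactor.Zfac
  split_ifs with he
  · simp only [norm_mul, norm_inv]
    rw [hπ1, hk1, e1, e2, norm_Gamma_conj, norm_Gamma_conj]
  · simp only [norm_mul, norm_inv, norm_neg]
    rw [hπ1, hk1, e3, e4, norm_Gamma_conj, norm_Gamma_conj]

/-- **`|Z(z,θ)| ≤ 64π²k²(1+|Im z|)^{3/2}` for `θ` primitive mod `k`, `−1 ≤ Re z < 1`, `|Im z| ≥ 1`**
(the tree's Stirling bound `Section6Statements.norm_Zfac_le_poly` for `Im z ≥ 1`, transported to `Im z ≤ −1`
by `norm_Zfac_conj`). [cite: Zhang2022LandauSiegel, §2 (2.4)] -/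
theorem norm_Zfac_le_poly_abs {k : ℕ} [NeZero k] {θ : DirichletCharacter ℂ k}
    (hθ : θ.IsPrimitive) {z : ℂ} (h1 : -1 ≤ z.re) (h2 : z.re < 1) (ht : 1 ≤ |z.im|) :
    ‖GammaFactor.Zfac θ z‖ ≤ 64 * π ^ 2 * (k : ℝ) ^ 2 * (1 + |z.im|) ^ ((3 : ℝ) / 2) := by
  rcases le_or_gt 0 z.im with hpos | hneg
  · rw [abs_of_nonneg hpos] at ht ⊢
    have hz : z = ((z.re : ℝ) : ℂ) + (z.im : ℝ) * I := (Complex.re_add_im z).symm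
    rw [hz]
    simpa using Section6Statements.norm_Zfac_le_poly hθ h1 h2 ht
  · rw [abs_of_neg hneg] at ht ⊢
    rw [← norm_Zfac_conj]
    have hz : conj z = ((z.re : ℝ) : ℂ) + ((-z.im : ℝ) : ℂ) * I := by
      apply Complex.ext <;> simp
    rw [hz]
    have h := Section6Statements.norm_Zfac_le_poly hθ (σ' := z.re) (t' := -z.im) h1 h2 ht
    simpa using h

/-! ### Polynomial growth of `L(z,θ)` on `−1/2 ≤ Re z ≤ 3`, `|Im z| ≥ 1` -/

/-- `‖z‖ ≤ |Re z| + |Im z|`, packaged as `‖z‖ ≤ (A + 1)(1 + |Im z|)` when `|Re z| ≤ A`. [folklore] -/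
private theorem norm_le_of_abs_re_le {z : ℂ} {A : ℝ} (hA : |z.re| ≤ A) (hA0 : 0 ≤ A) :
    ‖z‖ ≤ (A + 1) * (1 + |z.im|) := by
  have h := Complex.norm_le_abs_re_add_abs_im z
  nlinarith [abs_nonneg z.im, abs_nonneg z.re]

/-- **Polynomial growth of `L(z,θ)` in the strip** — for `θ` primitive to a modulus `k ≠ 1` and
`−1/2 ≤ Re z ≤ 3`, `|Im z| ≥ 1`: `‖L(z,θ)‖ ≤ 160π²k³Z(1+|Im z|)³`, `Z = Σ_{n≥0}(n+1)^{−5/4}`.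
For `Re z ≥ 1/4` this is the crude bound `‖L(z,θ)‖ ≤ k‖z‖Z` [cite: MontgomeryVaughan2007, §10.2 Lemma 10.15]
(tree `DirichletZFR.norm_LFunction_le_of_re_ge`); for `Re z < 1/4` the functional equation (2.2)
`L(z,θ) = Z(z,θ)L(1−z,θ̄)` (`GammaFactor.LFunction_eq_Zfac_mul`) with `Re(1−z) ≥ 3/4` and
`|Z(z,θ)| ≤ 64π²k²(1+|Im z|)^{3/2}`. [cite: Zhang2022LandauSiegel, §4 Lemma 4.4 (proof) p. 19] -/
theorem norm_LFunction_le_strip {k : ℕ} [NeZero k] {θ : DirichletCharacter ℂ k}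
    (hθ : θ.IsPrimitive) (hk : k ≠ 1) {z : ℂ} (h1 : -1 / 2 ≤ z.re) (h2 : z.re ≤ 3)
    (ht : 1 ≤ |z.im|) :
    ‖θ.LFunction z‖ ≤ 160 * π ^ 2 * (k : ℝ) ^ 3 *
      (∑' n : ℕ, ((n + 1 : ℕ) : ℝ) ^ (-(5 / 4 : ℝ))) * (1 + |z.im|) ^ 3 := by
  set Z : ℝ := ∑' n : ℕ, ((n + 1 : ℕ) : ℝ) ^ (-(5 / 4 : ℝ)) with hZ
  have hZ1 : 1 ≤ Z := DirichletZFR.one_le_tsum_rpow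
  have hZ0 : 0 ≤ Z := by linarith
  have hk1 : (1 : ℝ) ≤ k := by exact_mod_cast Nat.one_le_iff_ne_zero.mpr (NeZero.ne k)
  have hk0 : (0 : ℝ) ≤ k := by linarith
  have hθ1 : θ ≠ 1 := GammaFactor.ne_one_of_isPrimitive hθ hk
  have hT : (1 : ℝ) ≤ 1 + |z.im| := by linarith [abs_nonneg z.im]
  have hT0 : (0 : ℝ) ≤ 1 + |z.im| := by linarith
  have hπ : (1 : ℝ) ≤ π ^ 2 := by nlinarith [Real.pi_gt_three]
  rcases le_or_gt (1 / 4 : ℝ) z.re with hre | hre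
  · -- the crude bound directly
    have h := DirichletZFR.norm_LFunction_le_of_re_ge θ hθ1 hre
    have hz : ‖z‖ ≤ 4 * (1 + |z.im|) :=
      (norm_le_of_abs_re_le (A := 3) (abs_le.mpr ⟨by linarith, h2⟩) (by norm_num)).trans
        (by linarith)
    calc ‖θ.LFunction z‖ ≤ k * ‖z‖ * Z := h
      _ ≤ k * (4 * (1 + |z.im|)) * Z := by gcongr
      _ = 4 * k * Z * (1 + |z.im|) := by ring
      _ ≤ 160 * π ^ 2 * (k : ℝ) ^ 3 * Z * (1 + |z.im|) ^ 3 := by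
          have h3 : (1 + |z.im|) ≤ (1 + |z.im|) ^ 3 := le_self_pow₀ hT (by norm_num)
          have hk3 : (k : ℝ) ≤ (k : ℝ) ^ 3 := le_self_pow₀ hk1 (by norm_num)
          have : 4 * (k : ℝ) * Z ≤ 160 * π ^ 2 * (k : ℝ) ^ 3 * Z := by
            have : 4 * (k : ℝ) ≤ 160 * π ^ 2 * (k : ℝ) ^ 3 := by
              nlinarith [mul_le_mul hπ hk3 hk0 (by positivity)]
            exact mul_le_mul_of_nonneg_right this hZ0
          exact mul_le_mul this h3 hT0 (by positivity)
  · -- the functional equation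
    have him : z.im ≠ 0 := fun h => by rw [h, abs_zero] at ht; linarith
    rw [GammaFactor.LFunction_eq_Zfac_mul hθ hk him, norm_mul]
    have hZb : ‖GammaFactor.Zfac θ z‖ ≤ 64 * π ^ 2 * (k : ℝ) ^ 2 * (1 + |z.im|) ^ 2 := by
      refine (norm_Zfac_le_poly_abs hθ (by linarith) (by linarith) ht).trans ?_
      gcongr
      calc (1 + |z.im|) ^ ((3 : ℝ) / 2) ≤ (1 + |z.im|) ^ ((2 : ℕ) : ℝ) :=
            Real.rpow_le_rpow_of_exponent_le hT (by norm_num)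
        _ = (1 + |z.im|) ^ 2 := Real.rpow_natCast _ 2
    have hθ1' : θ⁻¹ ≠ 1 := fun h => hθ1 (inv_eq_one.mp h)
    have hre' : (1 / 4 : ℝ) ≤ (1 - z).re := by simp; linarith
    have hL := DirichletZFR.norm_LFunction_le_of_re_ge θ⁻¹ hθ1' hre'
    have hz : ‖1 - z‖ ≤ (5 / 2) * (1 + |z.im|) := by
      have h' : |(1 - z).re| ≤ 3 / 2 := by
        rw [abs_le]; simp; constructor <;> linarith
      have := norm_le_of_abs_re_le h' (by norm_num)
      norm_num at this
      exact this
    have hLb : ‖θ⁻¹.LFunction (1 - z)‖ ≤ k * ((5 / 2) * (1 + |z.im|)) * Z := by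
      calc ‖θ⁻¹.LFunction (1 - z)‖ ≤ k * ‖1 - z‖ * Z := hL
        _ ≤ k * ((5 / 2) * (1 + |z.im|)) * Z := by gcongr
    calc ‖GammaFactor.Zfac θ z‖ * ‖θ⁻¹.LFunction (1 - z)‖
        ≤ (64 * π ^ 2 * (k : ℝ) ^ 2 * (1 + |z.im|) ^ 2) * (k * ((5 / 2) * (1 + |z.im|)) * Z) :=
          mul_le_mul hZb hLb (norm_nonneg _) (by positivity)
      _ = 160 * π ^ 2 * (k : ℝ) ^ 3 * Z * (1 + |z.im|) ^ 3 := by ring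

/-! ### The product `L(z,ψ)L(z,ψχ)` -/

/-- **Polynomial growth of `L(z,ψ)L(z,ψχ)` in the strip** (`ψ ∈ Ψ`, `χ` primitive mod `D ≥ 3`, so
that `ψ (mod p)` and `ψχ (mod Dp)` are primitive to moduli `≠ 1`): for `−1/2 ≤ Re z ≤ 3`,
`|Im z| ≥ 1`, `‖L(z,ψ)L(z,ψχ)‖ ≤ (160π²p³Z)(160π²(Dp)³Z)(1+|Im z|)⁶`.
[cite: Zhang2022LandauSiegel, §4 Lemma 4.4 (proof) p. 19] -/
theorem norm_LL_le_strip {D : ℕ} [NeZero D] (χ : DirichletCharacter ℂ D) (x : Chr D) (hD : 3 ≤ D)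
    (hχ : χ.IsPrimitive) {z : ℂ} (h1 : -1 / 2 ≤ z.re) (h2 : z.re ≤ 3) (ht : 1 ≤ |z.im|) :
    ‖LL χ x z‖ ≤ (160 * π ^ 2 * (x.p : ℝ) ^ 3 * (∑' n : ℕ, ((n + 1 : ℕ) : ℝ) ^ (-(5 / 4 : ℝ))))
      * (160 * π ^ 2 * ((D * x.p : ℕ) : ℝ) ^ 3 * (∑' n : ℕ, ((n + 1 : ℕ) : ℝ) ^ (-(5 / 4 : ℝ))))
      * (1 + |z.im|) ^ 6 := by
  have hDp : D * x.p ≠ 1 := fun h => by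
    have := Nat.eq_one_of_mul_eq_one_left h
    exact x.p_ne_one this
  have h1' := norm_LFunction_le_strip x.prim x.p_ne_one h1 h2 ht
  have h2' := norm_LFunction_le_strip (psiChiPrimitive_holds D χ x hD hχ) hDp h1 h2 ht
  rw [LL, norm_mul]
  calc ‖x.ψ.LFunction z‖ * ‖(psiChi χ x).LFunction z‖
      ≤ (160 * π ^ 2 * (x.p : ℝ) ^ 3 * (∑' n : ℕ, ((n + 1 : ℕ) : ℝ) ^ (-(5 / 4 : ℝ))) * (1 + |z.im|) ^ 3)
        * (160 * π ^ 2 * ((D * x.p : ℕ) : ℝ) ^ 3 * (∑' n : ℕ, ((n + 1 : ℕ) : ℝ) ^ (-(5 / 4 : ℝ)))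
          * (1 + |z.im|) ^ 3) := mul_le_mul h1' h2' (norm_nonneg _) (le_trans (norm_nonneg _) h1')
    _ = _ := by ring

end Literature.NumberTheory.LFunctions.Zhang2022.Section4

end
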